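import Literature.MathematicalPhysics.QuantumFieldTheory.Balaban1983to89.B7Eq136SecondOrder

/-!
# `Balaban1983to89.B7Eq136ThirdPolarization` — T. Bałaban, *Averaging operations for lattice gauge theories*, Commun. Math. Phys. **98**
(1985) 17–51 [Balaban1985Averaging], (136) p. 39 / *The variational problem and background fields …*, Commun. Math. Phys. **102** (1985)
277–309 [Balaban1985Variational], (56) p. 286: **THE POLARIZATION OF THE THIRD-ORDER TERM `C_j⁽³⁾(U₀, ·)` ON THE CONCRETE `ℤᵈ` CARRIER** —
the third Fréchet derivative `D³[C_j(U₀, ins_S ·)(c)](0)` of the remainder of [B7] (134)/(136) in the finitely many field variables: its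
diagonal is `3!` times the `t³`-coefficient of the slice, it is SYMMETRIC, and it obeys the (149)-type bound
`‖D³[C_j](0)(P, Q, R)‖ ≤ 4C₃(Lʲ)²b⁻¹‖P‖‖Q‖·Σ_s Q″_j(c, s)‖R_s‖` (two Cauchy estimates over [B7] (149)) — the trilinear «C^{(3)}» and its constant
`c₃` that [B11] (56) at order three takes from [B7]

statement-level skeleton of published theorems with citation tags; proofs where landed; nothing here is a claim about the Yang–Mills mass gap

PDF held: `paper:balaban1985-cmp98-averaging` (journal page = PDF page + 16), renders `…/1985-cmp98-averaging-p022-x2.png`–`p024-x2.png`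
(pp. 38–40) read as images (cell `b2b-balaban-ref1` page renders); `paper:balaban1985-cmp102-variational-background` p. 286 [PDF 10] (text
layer `p0010.txt`).

CITATION HEADER / WHAT IS REPRODUCED.  Cell `lit-balaban` (HOME `run/shared/lean/pub/lit-balaban/`), Phase-2 proof seat p06 gen 6 = unit
`lit-balaban-p06` (TAKING line HOME/STATUS.md 2026-08-21T11:01:20Z; file 2 of the `C_j⁽³⁾` lane; companion of `B7Eq136ThirdOrder` (the slice
object `CCovIter3`) and sequel of the gen-5 `B7Eq136SecondOrder` (the same facts for `C_j⁽²⁾`)); SKELETON rows **B7.Prop4 / B7.Eq127** (display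
(136); owner r04), **B7.Eq149** ((149); owner r04) and **B11.Eq55** ((56) at order three; owner r08: the HYPOTHESES «a trilinear `C3` with norm
bound `c₃`» of `B11Eq56Expansion.eq56_order3(_fixedPoint)`).  THE PRINT.  [B7] p. 39: *«The function C_k can be decomposed further into a sum of
homogeneous polynomials, C_k(U₀, A) = C_k^{(2)}(U₀, A) + C_k^{(3)}(U₀, A) + … . (136)»*, (137) *«dF(A, δA) = (d/dt)F(A + tδA)|_{t=0}»*, (138)
*«⟨(δ/δA)F(A), δA⟩ = Σ_b η^d tr((δ/δA_b)F(A)·δA_b)»*; p. 40: *«We will prove by induction that |⟨(δ/δA)C_j(U₀, A), δA⟩| ≦ C₃|A|Q″_j|δA|, (149)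
where the configurations A are considered on L^{−j}-lattice»*, (140) *«(Q″A)_c = Σ_{b⊂B(c₋)∪B(c₊)} L^{−d}A_b»*.  [B11] p. 286 (56): *«… where
C_j^{(n)}, D^{(n)} are homogeneous polynomials of n-th order. … D^{(3)}(A′) = C^{(3)}(LʲηA′) − 2C^{(2)}(LʲηA′, LʲηHC^{(2)}(A′)), and so on. Here
C_j^{(2)}(A′, A″) denotes a symmetric bilinear form obtained by polarization from the quadratic form C^{(2)}(A′)»*.  The statements below
(existence and symmetry of the trilinear polarization of `C^{(3)}`, and a (149)-type bound for it with the constant `4C₃(Lʲ)²/b`) are printed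
nowhere; they are what the Cauchy estimate gives from the printed (149) for the analytic `C_j(U₀, ·)` of Prop. 4 — our formalisation of the USE
[B11] (56) makes of «C^{(3)}» as a homogeneous polynomial of third order with a norm.

DICTIONARY (as `B7Ineq149Pairing` / `B7Eq136SecondOrder`; every level rescaled to `ℤᵈ`).  `C_j(U₀, B)(c)` ↦ `CCovIter L U₀ B j z κ` (`c = (z,
κ)`); the finitely many variables `B_s, s ∈ S` ↦ `a : S → 𝔸` inserted by `B7Prop3Flat.insCfg S a`, `f(a) := C_j(U₀, ins_S a)(c)`; THIS FILE:
**the third polarization `D³f(0) := fderiv ℂ (fderiv ℂ (fderiv ℂ f)) 0`** (a continuous trilinear map `𝔸^S → 𝔸^S → 𝔸^S → 𝔸`; `(3!)⁻¹·D³f(0)(a,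
a, a)` is `B7Eq136ThirdOrder.CCovIter3 L U₀ (ins_S a) j z κ` by `iteratedDeriv_three_CCovIter_ins_slice` below and `CCovIter3_def` there);
`C₃|A|Q″_j|δA|(c)` ↦ `C3Gen d L·(Lʲ)²·(radius)·Σ_{s∈S} kerQdd L j z κ s·‖δa_s‖` ((141) `kerQdd = L^{−jd}𝟙[s ⊂ Bʲ(c₋) ∪ Bʲ(c₊)]`).  Regime = that of
`B7Eq136SecondOrder` / `B7Ineq149Pairing` (`L ≥ 2`, structure group `AvgClosed`, (52) `pdev U₀ < α₀L^{−2k}`, `C₀α₀ ≤ ⅓`, `4α₀ ≤ c₂′`,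
(145)/(155) smallness `h145`/`h155`) at a witness radius `b > 0` (`hsmall`, `hc₃`, `h155` mention `Lᵏb`); `j ≤ k`.

WHAT THIS FILE PROVES (theorems only; kernel, 0 sorry, standard axioms).
* §0 (generic, private, [folklore]) slice/line calculus: `(d/dt)Df(v + tQ)R|₀ = D²f(v)(Q)(R)`, `(d/ds)D²f(sP)(Q)(R)|₀ = D³f(0)(P)(Q)(R)`,
  `(d³/dt³)f(ta)|₀ = D³f(0)(a)(a)(a)` for `f` analytic near `0`.
* §1 on `𝔸^S`, `j ≤ k`, `f = C_j(U₀, ins_S ·)(c)`: `eventually_analyticAt_CCovIter_ins` (analytic near `0`), `hasFDerivAt_fderiv2_CCovIter_ins_zero`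
  (`D³f(0)` exists as the derivative of `D²f`), **`iteratedDeriv_three_CCovIter_ins_slice`** (`(d³/dt³)C_j(U₀, t·ins_S a)(c)|₀ = D³f(0)(a, a, a)`
  — the diagonal of the polarization is `3!·C_j⁽³⁾`), **`third_fderiv_CCovIter_ins_symm₁₂` / `…_symm₂₃`** (the polarization is SYMMETRIC),
  **`norm_snd_fderiv_CCovIter_ins_le_at`** (`‖D²f(v)(Q)(R)‖ ≤ 2C₃(Lʲ)²‖Q‖·Σ_s kerQdd(c, s)‖R_s‖` at EVERY `v` with `‖v_s‖ ≤ b/2` — Cauchy in `t`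
  on `Df(v + tQ)R` over (149) = `B7Ineq149Pairing.ineq149_pairing`), **`norm_third_fderiv_CCovIter_ins_le`** (`‖D³f(0)(P)(Q)(R)‖ ≤
  4C₃(Lʲ)²b⁻¹‖P‖‖Q‖·Σ_s kerQdd(c, s)‖R_s‖` — Cauchy in `s` on `D²f(sP)(Q)(R)`), `norm_third_fderiv_CCovIter_ins_le'` (`≤ 8d·C₃(Lʲ)²b⁻¹‖P‖‖Q‖‖R‖`,
  count (141)/(142)), `norm_iteratedDeriv_three_CCovIter_ins_slice_le` (the diagonal: `≤ 8d·C₃(Lʲ)²b⁻¹‖a‖³`).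
NOT CLAIMED: anything about `C^{(n)}`, `n ≥ 4`; locality of `C⁽³⁾(U₀, B)(c)` in `B` beyond the `kerQdd`-support of the last slot; optimality of
the constant (the `b⁻¹` is the price of two Cauchy estimates at the witness radius).  NOT summit progress.
-/

noncomputable section

open scoped BigOperators Topology
open NormedSpace Finset Metric Filter

namespace Literature.MathematicalPhysics.QuantumFieldTheory.Balaban1983to89.B7Eq136ThirdPolarization

open B7Prop1Explicit B7Prop1Local B7Prop2Explicit B7Prop3Flat B7Prop4Flat B7Eq92Concrete B7Prop3GeneralLinear
  B7Prop4GeneralLevels B7Ineq148 B7Prop5GeneralOperators B7Prop5GeneralLinear B7Prop5GeneralInduction B7Prop5GeneralLevels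
  B7Prop5General B7Ineq149Pairing B7Eq136SecondOrder
open B7Prop5FlatOperator (norm_insCfg_le_of_le)

-- `Site` alone would resolve to the torus sites of `Setup.lean`; re-export the `ℤ^d` sites of `B7Prop1Explicit`.
export B7Prop1Explicit (Site)

variable {d : ℕ}

/-! ## §0 Line calculus for first, second and third derivatives (generic, private) -/

section LineCalculus

variable {E F : Type*} [NormedAddCommGroup E] [NormedSpace ℂ E] [NormedAddCommGroup F] [NormedSpace ℂ F]

/-- `(d/dt) Df(v + t·Q)(R)|_{t=0} = D²f(v)(Q)(R)` when `Df` is Fréchet-differentiable at `v` with derivative `D²f(v)` ([B7] (137) applied to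
`Df(·)R`). [folklore] -/
private theorem hasDerivAt_fderiv_line {f : E → F} {v : E} {D2 : E →L[ℂ] E →L[ℂ] F} (hF2 : HasFDerivAt (fderiv ℂ f) D2 v)
    (Q R : E) : HasDerivAt (fun t : ℂ => fderiv ℂ f (v + t • Q) R) (D2 Q R) 0 := by
  have hℓ : HasDerivAt (fun t : ℂ => v + t • Q) Q 0 := by
    simpa using ((hasDerivAt_id (0 : ℂ)).smul_const Q).const_add v
  have hF2' : HasFDerivAt (fderiv ℂ f) D2 (v + (0 : ℂ) • Q) := by rwa [zero_smul, add_zero]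
  have hφ : HasFDerivAt (fun u : E => fderiv ℂ f u R) ((ContinuousLinearMap.apply ℂ F R).comp D2) (v + (0 : ℂ) • Q) :=
    (ContinuousLinearMap.apply ℂ F R).hasFDerivAt.comp (v + (0 : ℂ) • Q) hF2'
  have h := hφ.comp_hasDerivAt (0 : ℂ) hℓ
  simpa [Function.comp_def] using h

variable [CompleteSpace F]

/-- `(d/ds) D²f(s·P)(Q)(R)|_{s=0} = D³f(0)(P)(Q)(R)` for `f` analytic at `0` (`D²f` is then Fréchet-differentiable at `0` with derivative
`D³f(0)`). [folklore] -/
private theorem hasDerivAt_fderiv2_line {f : E → F} (hf : AnalyticAt ℂ f 0) (P Q R : E) :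
    HasDerivAt (fun s : ℂ => fderiv ℂ (fderiv ℂ f) (s • P) Q R) (fderiv ℂ (fderiv ℂ (fderiv ℂ f)) 0 P Q R) 0 := by
  have hℓ : HasDerivAt (fun s : ℂ => s • P) P 0 := by simpa using (hasDerivAt_id (0 : ℂ)).smul_const P
  have hF3 := hf.fderiv.fderiv.differentiableAt.hasFDerivAt
  rw [← zero_smul ℂ P] at hF3
  -- `D²f` along the line, then evaluate at the constant vectors `Q` and `R`
  have ha := hF3.comp_hasDerivAt (0 : ℂ) hℓ
  have hb := (ha.clm_apply (hasDerivAt_const (0 : ℂ) Q)).clm_apply (hasDerivAt_const (0 : ℂ) R)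
  simpa [Function.comp_def] using hb

/-- the third `t`-derivative of the slice `t ↦ f(t·a)` at `0` is `D³f(0)(a)(a)(a)`, for `f` analytic near `0` (chain rule three times;
derivatives of eventually equal functions agree). [folklore] -/
private theorem iteratedDeriv_three_slice {f : E → F} (hf : ∀ᶠ v in 𝓝 (0 : E), AnalyticAt ℂ f v) (a : E) :
    iteratedDeriv 3 (fun t : ℂ => f (t • a)) 0 = fderiv ℂ (fderiv ℂ (fderiv ℂ f)) 0 a a a := by
  have hline : Tendsto (fun t : ℂ => t • a) (𝓝 0) (𝓝 (0 : E)) := by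
    have hc : Continuous (fun t : ℂ => t • a) := continuous_id.smul continuous_const
    simpa using hc.tendsto 0
  have hev : ∀ᶠ t : ℂ in 𝓝 0, AnalyticAt ℂ f (t • a) := hline.eventually hf
  have hℓ : ∀ t : ℂ, HasDerivAt (fun s : ℂ => s • a) a t := fun t => by simpa using (hasDerivAt_id t).smul_const a
  -- first derivative along the line, near `0`
  have h1 : deriv (fun t : ℂ => f (t • a)) =ᶠ[𝓝 (0 : ℂ)] fun t => fderiv ℂ f (t • a) a := by
    filter_upwards [hev] with t ht
    exact (ht.differentiableAt.hasFDerivAt.comp_hasDerivAt t (hℓ t)).deriv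
  -- second derivative along the line, near `0`
  have h2 : deriv (fun t : ℂ => fderiv ℂ f (t • a) a) =ᶠ[𝓝 (0 : ℂ)] fun t => fderiv ℂ (fderiv ℂ f) (t • a) a a := by
    filter_upwards [hev] with t ht
    have hF2 : HasFDerivAt (fderiv ℂ f) (fderiv ℂ (fderiv ℂ f) (t • a)) (t • a) :=
      ht.fderiv.differentiableAt.hasFDerivAt
    have hφ : HasFDerivAt (fun u : E => fderiv ℂ f u a)
        ((ContinuousLinearMap.apply ℂ F a).comp (fderiv ℂ (fderiv ℂ f) (t • a))) (t • a) :=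
      (ContinuousLinearMap.apply ℂ F a).hasFDerivAt.comp (t • a) hF2
    have h := hφ.comp_hasDerivAt t (hℓ t)
    simpa [Function.comp_def] using h.deriv
  -- third derivative at `0`
  have h0 : AnalyticAt ℂ f 0 := hf.self_of_nhds
  have h3 := hasDerivAt_fderiv2_line h0 a a a
  rw [iteratedDeriv_succ, iteratedDeriv_succ, iteratedDeriv_one, (h1.deriv.trans h2).deriv_eq, h3.deriv]

end LineCalculus

/-! ## §1 On the variable space `𝔸^S`: the third polarization of `C_j(U₀, ·)(c)` -/

section Regime

variable {𝔸 : Type*} [NormedRing 𝔸] [NormedAlgebra ℂ 𝔸] [CompleteSpace 𝔸] [NormOneClass 𝔸]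

/-- `C₃ ≥ 0`. [folklore] -/
private theorem C3Gen_nonneg' (d L : ℕ) : 0 ≤ C3Gen d L := by
  unfold C3Gen C1ppGen; positivity

variable (L : ℕ) (hL : 2 ≤ L) {G : Subgroup 𝔸ˣ} (hG : AvgClosed d L G) (k : ℕ)
  (U₀ : Site d → Fin d → 𝔸ˣ) (hU₀ : ∀ x κ, U₀ x κ ∈ G) {α₀ : ℝ} (hα : 0 < α₀)
  (hα3 : C0 d * α₀ ≤ 1 / 3) (hα4 : 4 * α₀ ≤ c2' d L) (h52 : pdev U₀ < α₀ * (((L : ℝ) ^ k)⁻¹) ^ 2)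
  {b : ℝ} (hb : 0 < b)
  (hsmall : Real.exp (4 * (800 * ((d : ℝ) + 1) ^ 2 * ((d : ℝ) + 4)) * α₀)
    * (1 + 8 * (131072 * ((d : ℝ) + 1) ^ 2) * ((L : ℝ) ^ k * b)) ≤ 2)
  (hc₃ : 4 * ((L : ℝ) ^ k * b) < c3 d L)
  (h145 : 8 * d * thetaGen d L α₀ * (L : ℝ)⁻¹ ^ 4 ≤ 1)
  (h155 : (2 * (L : ℝ) - 1) * (L : ℝ)⁻¹ ^ 2 + 2 * d * thetaGen d L α₀ * (L : ℝ)⁻¹ ^ 3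
    + 1 / 8 * (1 + 2 * d * thetaGen d L α₀ * (L : ℝ)⁻¹ ^ 2 + 2 * d * C3Gen d L * ((L : ℝ) ^ k * b)) * (L : ℝ)⁻¹ ^ 2 ≤ 1)
  (S : Finset (Site d × Fin d))

include hL hG hU₀ hα hα3 hα4 h52 hb hsmall hc₃ in
/-- `f = C_j(U₀, ins_S ·)(c)` IS ANALYTIC AT EVERY POINT NEAR `0` (indeed on the closed polydisc `‖a_s‖ ≤ b`,
`B7Eq136SecondOrder.analyticAt_CCovIter_ins`; the open sup-ball of radius `b` is a neighbourhood of `0`). [cite: Balaban1985Averaging, Prop. 4 p.38, (136) p.39] -/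
theorem eventually_analyticAt_CCovIter_ins {j : ℕ} (hj : j ≤ k) (z : Site d) (κ : Fin d) :
    ∀ᶠ v in 𝓝 (0 : S → 𝔸), AnalyticAt ℂ (fun a' : S → 𝔸 => CCovIter L U₀ (insCfg S a') j z κ) v := by
  filter_upwards [ball_mem_nhds (0 : S → 𝔸) hb] with v hv
  exact analyticAt_CCovIter_ins L hL hG k U₀ hU₀ hα hα3 hα4 h52 hb hsmall hc₃ S hj z κ
    (fun s => (norm_le_pi_norm v s).trans (mem_ball_zero_iff.1 hv).le)

include hL hG hU₀ hα hα3 hα4 h52 hb hsmall hc₃ in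
/-- **the third polarization exists**: `D²f = fderiv ℂ (fderiv ℂ f)` is Fréchet-differentiable at `0` with derivative the continuous trilinear
map `D³f(0) = fderiv ℂ (fderiv ℂ (fderiv ℂ f)) 0` (analyticity). [cite: Balaban1985Averaging, (136) p.39] [cite: Balaban1985Variational, (56) p.286] -/
theorem hasFDerivAt_fderiv2_CCovIter_ins_zero {j : ℕ} (hj : j ≤ k) (z : Site d) (κ : Fin d) :
    HasFDerivAt (fderiv ℂ (fderiv ℂ (fun a' : S → 𝔸 => CCovIter L U₀ (insCfg S a') j z κ)))
      (fderiv ℂ (fderiv ℂ (fderiv ℂ (fun a' : S → 𝔸 => CCovIter L U₀ (insCfg S a') j z κ))) 0) 0 := by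
  have han : AnalyticAt ℂ (fun a' : S → 𝔸 => CCovIter L U₀ (insCfg S a') j z κ) 0 :=
    analyticAt_CCovIter_ins L hL hG k U₀ hU₀ hα hα3 hα4 h52 hb hsmall hc₃ S hj z κ (fun s => by simpa using hb.le)
  exact han.fderiv.fderiv.differentiableAt.hasFDerivAt

include hL hG hU₀ hα hα3 hα4 h52 hb hsmall hc₃ in
/-- **THE DIAGONAL OF THE THIRD POLARIZATION IS THE THIRD SLICE DERIVATIVE**: `(d³/dt³)C_j(U₀, t·ins_S a)(c)|_{t=0} = D³f(0)(a)(a)(a)` — so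
`B7Eq136ThirdOrder.CCovIter3 L U₀ (ins_S a) j z κ = (3!)⁻¹·D³f(0)(a, a, a)`: the `t³`-coefficient of [B7] (136)/(137) along the inserted line is
the cubic form of the polarization ([B11] (56) «homogeneous polynomials of n-th order … obtained by polarization»).
[cite: Balaban1985Averaging, (136)–(137) p.39] [cite: Balaban1985Variational, (56) p.286] -/
theorem iteratedDeriv_three_CCovIter_ins_slice {j : ℕ} (hj : j ≤ k) (z : Site d) (κ : Fin d) (a : S → 𝔸) :
    iteratedDeriv 3 (fun t : ℂ => CCovIter L U₀ (t • insCfg S a) j z κ) 0 =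
      fderiv ℂ (fderiv ℂ (fderiv ℂ (fun a' : S → 𝔸 => CCovIter L U₀ (insCfg S a') j z κ))) 0 a a a := by
  have hslice : (fun t : ℂ => CCovIter L U₀ (t • insCfg S a) j z κ) =
      fun t : ℂ => (fun a' : S → 𝔸 => CCovIter L U₀ (insCfg S a') j z κ) (t • a) := by
    funext t; simp only [insCfg_smul]
  rw [hslice]
  exact iteratedDeriv_three_slice (eventually_analyticAt_CCovIter_ins L hL hG k U₀ hU₀ hα hα3 hα4 h52 hb hsmall hc₃ S hj z κ) a

include hL hG hU₀ hα hα3 hα4 h52 hb hsmall hc₃ in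
/-- **THE THIRD POLARIZATION IS SYMMETRIC in its first two slots**: `D³f(0)(P)(Q)(R) = D³f(0)(Q)(P)(R)` (second derivatives of the analytic map
`Df` commute). [cite: Balaban1985Variational, (56) p.286] [cite: Balaban1985Averaging, (136) p.39] -/
theorem third_fderiv_CCovIter_ins_symm₁₂ {j : ℕ} (hj : j ≤ k) (z : Site d) (κ : Fin d) (P Q R : S → 𝔸) :
    fderiv ℂ (fderiv ℂ (fderiv ℂ (fun a' : S → 𝔸 => CCovIter L U₀ (insCfg S a') j z κ))) 0 P Q R =
      fderiv ℂ (fderiv ℂ (fderiv ℂ (fun a' : S → 𝔸 => CCovIter L U₀ (insCfg S a') j z κ))) 0 Q P R := by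
  have han : AnalyticAt ℂ (fun a' : S → 𝔸 => CCovIter L U₀ (insCfg S a') j z κ) 0 :=
    analyticAt_CCovIter_ins L hL hG k U₀ hU₀ hα hα3 hα4 h52 hb hsmall hc₃ S hj z κ (fun s => by simpa using hb.le)
  have h := (han.fderiv.contDiffAt (n := ⊤)).isSymmSndFDerivAt_of_omega P Q
  rw [h]

include hL hG hU₀ hα hα3 hα4 h52 hb hsmall hc₃ in
/-- **THE THIRD POLARIZATION IS SYMMETRIC in its last two slots**: `D³f(0)(P)(Q)(R) = D³f(0)(P)(R)(Q)` — along the line `s ↦ sP` the second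
derivatives `D²f(sP)` are symmetric for `s` near `0` (analyticity near `0`), and `D³f(0)(P)(·)(·)` is the `s`-derivative at `0`.
[cite: Balaban1985Variational, (56) p.286] [cite: Balaban1985Averaging, (136)–(137) p.39] -/
theorem third_fderiv_CCovIter_ins_symm₂₃ {j : ℕ} (hj : j ≤ k) (z : Site d) (κ : Fin d) (P Q R : S → 𝔸) :
    fderiv ℂ (fderiv ℂ (fderiv ℂ (fun a' : S → 𝔸 => CCovIter L U₀ (insCfg S a') j z κ))) 0 P Q R =
      fderiv ℂ (fderiv ℂ (fderiv ℂ (fun a' : S → 𝔸 => CCovIter L U₀ (insCfg S a') j z κ))) 0 P R Q := by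
  set f := fun a' : S → 𝔸 => CCovIter L U₀ (insCfg S a') j z κ with hf
  have han : AnalyticAt ℂ f 0 :=
    analyticAt_CCovIter_ins L hL hG k U₀ hU₀ hα hα3 hα4 h52 hb hsmall hc₃ S hj z κ (fun s => by simpa using hb.le)
  have hQR := (hasDerivAt_fderiv2_line han P Q R).deriv
  have hRQ := (hasDerivAt_fderiv2_line han P R Q).deriv
  -- the two line functions agree near `0`
  have hline : Tendsto (fun s : ℂ => s • P) (𝓝 0) (𝓝 (0 : S → 𝔸)) := by
    have hc : Continuous (fun s : ℂ => s • P) := continuous_id.smul continuous_const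
    simpa using hc.tendsto 0
  have hev : (fun s : ℂ => fderiv ℂ (fderiv ℂ f) (s • P) Q R) =ᶠ[𝓝 (0 : ℂ)]
      fun s : ℂ => fderiv ℂ (fderiv ℂ f) (s • P) R Q := by
    filter_upwards [hline.eventually
      (eventually_analyticAt_CCovIter_ins L hL hG k U₀ hU₀ hα hα3 hα4 h52 hb hsmall hc₃ S hj z κ)] with s hs
    exact (hs.contDiffAt (n := ⊤)).isSymmSndFDerivAt_of_omega Q R
  rw [← hQR, ← hRQ, hev.deriv_eq]

include hL hG hU₀ hα hα3 hα4 h52 hb hsmall hc₃ h145 h155 in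
/-- **THE SECOND DERIVATIVE AT A GENERAL POINT OF THE HALF POLYDISC obeys a (149)-type bound**: for every `v` with `‖v_s‖ ≤ b/2` and all `Q, R`,
`‖D²f(v)(Q)(R)‖ ≤ 2·C₃·(Lʲ)²·‖Q‖·Σ_{s∈S} kerQdd(c, s)·‖R_s‖`.  Proof: `g(t) = Df(v + tQ)R` is analytic on the closed disc `|t| ≤ b/(2‖Q‖)` (there
`‖(v + tQ)_s‖ ≤ b`), bounded by (149) `‖g(t)‖ ≤ C₃(Lʲ)²b·Σ_s kerQdd(c, s)‖R_s‖` (`B7Ineq149Pairing.ineq149_pairing`), and `g′(0) = D²f(v)(Q)(R)`;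
Cauchy's estimate divides by the radius. [cite: Balaban1985Averaging, (149) p.40, (136)–(137) p.39] -/
theorem norm_snd_fderiv_CCovIter_ins_le_at {j : ℕ} (hj : j ≤ k) (z : Site d) (κ : Fin d) {v : S → 𝔸} (hv : ∀ s, ‖v s‖ ≤ b / 2)
    (Q R : S → 𝔸) :
    ‖fderiv ℂ (fderiv ℂ (fun a' : S → 𝔸 => CCovIter L U₀ (insCfg S a') j z κ)) v Q R‖ ≤
      2 * (C3Gen d L * ((L : ℝ) ^ j) ^ 2) * ‖Q‖ * ∑ s : S, kerQdd L j z κ s.1.1 s.1.2 * ‖R s‖ := by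
  set f := fun a' : S → 𝔸 => CCovIter L U₀ (insCfg S a') j z κ with hf
  set Ssum : ℝ := ∑ s : S, kerQdd L j z κ s.1.1 s.1.2 * ‖R s‖ with hSsum
  have hSsum0 : 0 ≤ Ssum := sum_nonneg fun s _ => mul_nonneg (kerQdd_nonneg L j z κ _ _) (norm_nonneg _)
  have hC := C3Gen_nonneg' d L
  by_cases hQ0 : Q = 0
  · subst hQ0
    simp
  have hQpos : 0 < ‖Q‖ := norm_pos_iff.mpr hQ0
  set ρ : ℝ := b / (2 * ‖Q‖) with hρ
  have hρpos : 0 < ρ := div_pos hb (by positivity)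
  -- points of the closed `t`-disc lie in the polydisc of radius `b`
  have hpt : ∀ t : ℂ, ‖t‖ ≤ ρ → ∀ s, ‖(v + t • Q) s‖ ≤ b := by
    intro t ht s
    have h1 : ‖t‖ * ‖Q s‖ ≤ ρ * ‖Q‖ := mul_le_mul ht (norm_le_pi_norm Q s) (norm_nonneg _) hρpos.le
    have h2 : ρ * ‖Q‖ = b / 2 := by rw [hρ]; field_simp
    calc ‖(v + t • Q) s‖ = ‖v s + t • Q s‖ := rfl
      _ ≤ ‖v s‖ + ‖t • Q s‖ := norm_add_le _ _
      _ = ‖v s‖ + ‖t‖ * ‖Q s‖ := by rw [norm_smul]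
      _ ≤ b / 2 + b / 2 := add_le_add (hv s) (h1.trans h2.le)
      _ = b := by ring
  -- `g(t) = Df(v + tQ)R` is differentiable on the closed disc
  have hdiff : DiffContOnCl ℂ (fun t : ℂ => fderiv ℂ f (v + t • Q) R) (ball (0 : ℂ) ρ) := by
    refine DifferentiableOn.diffContOnCl fun t ht => ?_
    rw [closure_ball (0 : ℂ) hρpos.ne', mem_closedBall_zero_iff] at ht
    have han : AnalyticAt ℂ f (v + t • Q) :=
      analyticAt_CCovIter_ins L hL hG k U₀ hU₀ hα hα3 hα4 h52 hb hsmall hc₃ S hj z κ (hpt t ht)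
    have hℓ : DifferentiableAt ℂ (fun t : ℂ => v + t • Q) t :=
      (differentiableAt_const v).add (differentiableAt_id.smul_const Q)
    have hg : DifferentiableAt ℂ (fun u : S → 𝔸 => fderiv ℂ f u R) (v + t • Q) :=
      (ContinuousLinearMap.apply ℂ 𝔸 R).differentiableAt.comp (v + t • Q) han.fderiv.differentiableAt
    exact (hg.comp t hℓ).differentiableWithinAt
  -- (149) on the circle
  have hsph : ∀ t ∈ sphere (0 : ℂ) ρ, ‖fderiv ℂ f (v + t • Q) R‖ ≤ C3Gen d L * (((L : ℝ) ^ j) ^ 2 * b) * Ssum := by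
    intro t ht
    have htn : ‖t‖ = ρ := by simpa using ht
    exact (ineq149_pairing L hL hG k U₀ hU₀ hα hα3 hα4 h52 hb hsmall hc₃ h145 h155 S (hpt t htn.le) hj z κ R).2
  -- Cauchy's estimate for `g′(0) = D²f(v)(Q)(R)`
  have han_v : AnalyticAt ℂ f v :=
    analyticAt_CCovIter_ins L hL hG k U₀ hU₀ hα hα3 hα4 h52 hb hsmall hc₃ S hj z κ
      (fun s => by simpa using hpt 0 (by simpa using hρpos.le) s)
  have hF2 : HasFDerivAt (fderiv ℂ f) (fderiv ℂ (fderiv ℂ f) v) v := han_v.fderiv.differentiableAt.hasFDerivAt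
  have hderiv := (hasDerivAt_fderiv_line hF2 Q R).deriv
  have hcauchy := Complex.norm_deriv_le_of_forall_mem_sphere_norm_le hρpos hdiff hsph
  rw [hderiv] at hcauchy
  refine hcauchy.trans (le_of_eq ?_)
  rw [hρ]
  have hb0 : b ≠ 0 := hb.ne'
  have hQ0' : ‖Q‖ ≠ 0 := hQpos.ne'
  field_simp

include hL hG hU₀ hα hα3 hα4 h52 hb hsmall hc₃ h145 h155 in
/-- **THE (149)-TYPE BOUND FOR THE THIRD POLARIZATION**: for all `P, Q, R ∈ 𝔸^S`,
`‖D³f(0)(P)(Q)(R)‖ ≤ 4·C₃·(Lʲ)²·b⁻¹·‖P‖·‖Q‖·Σ_{s∈S} kerQdd(c, s)·‖R_s‖` — «C₃|A|Q″_j|δA|» twice differentiated: `h(s) = D²f(sP)(Q)(R)` is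
analytic on the closed disc `|s| ≤ b/(2‖P‖)` (there `‖(sP)_t‖ ≤ b/2`), bounded by `2C₃(Lʲ)²‖Q‖Σ…` (`norm_snd_fderiv_CCovIter_ins_le_at`), and `h′(0) =
D³f(0)(P)(Q)(R)`; Cauchy's estimate divides by the radius once more (the constant `c₃` of [B11] (56), concretely, up to the `(3!)⁻¹`).
[cite: Balaban1985Averaging, (149) p.40, (136)–(137) p.39] [cite: Balaban1985Variational, (56) p.286] -/
theorem norm_third_fderiv_CCovIter_ins_le {j : ℕ} (hj : j ≤ k) (z : Site d) (κ : Fin d) (P Q R : S → 𝔸) :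
    ‖fderiv ℂ (fderiv ℂ (fderiv ℂ (fun a' : S → 𝔸 => CCovIter L U₀ (insCfg S a') j z κ))) 0 P Q R‖ ≤
      4 * (C3Gen d L * ((L : ℝ) ^ j) ^ 2) * b⁻¹ * ‖P‖ * ‖Q‖ * ∑ s : S, kerQdd L j z κ s.1.1 s.1.2 * ‖R s‖ := by
  set f := fun a' : S → 𝔸 => CCovIter L U₀ (insCfg S a') j z κ with hf
  set Ssum : ℝ := ∑ s : S, kerQdd L j z κ s.1.1 s.1.2 * ‖R s‖ with hSsum
  have hSsum0 : 0 ≤ Ssum := sum_nonneg fun s _ => mul_nonneg (kerQdd_nonneg L j z κ _ _) (norm_nonneg _)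
  have hC := C3Gen_nonneg' d L
  by_cases hP0 : P = 0
  · subst hP0
    simp
  have hPpos : 0 < ‖P‖ := norm_pos_iff.mpr hP0
  set σ : ℝ := b / (2 * ‖P‖) with hσ
  have hσpos : 0 < σ := div_pos hb (by positivity)
  -- points of the closed `s`-disc lie in the HALF polydisc
  have hpt : ∀ s : ℂ, ‖s‖ ≤ σ → ∀ t, ‖(s • P) t‖ ≤ b / 2 := by
    intro s hs t
    have h1 : ‖s‖ * ‖P t‖ ≤ σ * ‖P‖ := mul_le_mul hs (norm_le_pi_norm P t) (norm_nonneg _) hσpos.le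
    have h2 : σ * ‖P‖ = b / 2 := by rw [hσ]; field_simp
    calc ‖(s • P) t‖ = ‖s‖ * ‖P t‖ := by rw [Pi.smul_apply, norm_smul]
      _ ≤ b / 2 := h1.trans h2.le
  have hpt' : ∀ s : ℂ, ‖s‖ ≤ σ → ∀ t, ‖(s • P) t‖ ≤ b := fun s hs t => (hpt s hs t).trans (by linarith)
  -- `h(s) = D²f(sP)(Q)(R)` is differentiable on the closed disc
  have hdiff : DiffContOnCl ℂ (fun s : ℂ => fderiv ℂ (fderiv ℂ f) (s • P) Q R) (ball (0 : ℂ) σ) := by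
    refine DifferentiableOn.diffContOnCl fun s hs => ?_
    rw [closure_ball (0 : ℂ) hσpos.ne', mem_closedBall_zero_iff] at hs
    have han : AnalyticAt ℂ f (s • P) :=
      analyticAt_CCovIter_ins L hL hG k U₀ hU₀ hα hα3 hα4 h52 hb hsmall hc₃ S hj z κ (hpt' s hs)
    have hℓ : DifferentiableAt ℂ (fun s : ℂ => s • P) s := differentiableAt_id.smul_const P
    have hg := ((ContinuousLinearMap.apply ℂ 𝔸 R).comp
      (ContinuousLinearMap.apply ℂ ((S → 𝔸) →L[ℂ] 𝔸) Q)).differentiableAt.comp (s • P) han.fderiv.fderiv.differentiableAt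
    exact (hg.comp s hℓ).differentiableWithinAt
  -- the second-derivative bound on the circle
  have hsph : ∀ s ∈ sphere (0 : ℂ) σ, ‖fderiv ℂ (fderiv ℂ f) (s • P) Q R‖ ≤
      2 * (C3Gen d L * ((L : ℝ) ^ j) ^ 2) * ‖Q‖ * Ssum := by
    intro s hs
    have hsn : ‖s‖ = σ := by simpa using hs
    exact norm_snd_fderiv_CCovIter_ins_le_at L hL hG k U₀ hU₀ hα hα3 hα4 h52 hb hsmall hc₃ h145 h155 S hj z κ (hpt s hsn.le) Q R
  -- Cauchy's estimate for `h′(0) = D³f(0)(P)(Q)(R)`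
  have han0 : AnalyticAt ℂ f 0 :=
    analyticAt_CCovIter_ins L hL hG k U₀ hU₀ hα hα3 hα4 h52 hb hsmall hc₃ S hj z κ (fun s => by simpa using hb.le)
  have hderiv := (hasDerivAt_fderiv2_line han0 P Q R).deriv
  have hcauchy := Complex.norm_deriv_le_of_forall_mem_sphere_norm_le hσpos hdiff hsph
  rw [hderiv] at hcauchy
  refine hcauchy.trans (le_of_eq ?_)
  rw [hσ]
  have hb0 : b ≠ 0 := hb.ne'
  have hP0' : ‖P‖ ≠ 0 := hPpos.ne'
  field_simp
  ring

include hL hG hU₀ hα hα3 hα4 h52 hb hsmall hc₃ h145 h155 in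
/-- the (149)-type bound with the count `Σ_s kerQdd(c, s)‖R_s‖ ≤ 2d‖R‖` of (141)/(142) (`B7Ineq149Pairing.sum_kerQdd_mul_norm_le`):
`‖D³f(0)(P)(Q)(R)‖ ≤ 8d·C₃·(Lʲ)²·b⁻¹·‖P‖·‖Q‖·‖R‖` — the trilinear norm bound `c₃` of [B11] (56) up to the `(3!)⁻¹`.
[cite: Balaban1985Averaging, (149) p.40, (141)–(142) p.39] [cite: Balaban1985Variational, (56) p.286] -/
theorem norm_third_fderiv_CCovIter_ins_le' {j : ℕ} (hj : j ≤ k) (z : Site d) (κ : Fin d) (P Q R : S → 𝔸) :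
    ‖fderiv ℂ (fderiv ℂ (fderiv ℂ (fun a' : S → 𝔸 => CCovIter L U₀ (insCfg S a') j z κ))) 0 P Q R‖ ≤
      8 * d * (C3Gen d L * ((L : ℝ) ^ j) ^ 2) * b⁻¹ * ‖P‖ * ‖Q‖ * ‖R‖ := by
  have hL1 : 1 ≤ L := le_trans (by norm_num) hL
  have hC := C3Gen_nonneg' d L
  have h := norm_third_fderiv_CCovIter_ins_le L hL hG k U₀ hU₀ hα hα3 hα4 h52 hb hsmall hc₃ h145 h155 S hj z κ P Q R
  have hK : 0 ≤ 4 * (C3Gen d L * ((L : ℝ) ^ j) ^ 2) * b⁻¹ * ‖P‖ * ‖Q‖ := by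
    have := hb.le
    positivity
  refine h.trans ?_
  calc 4 * (C3Gen d L * ((L : ℝ) ^ j) ^ 2) * b⁻¹ * ‖P‖ * ‖Q‖ * ∑ s : S, kerQdd L j z κ s.1.1 s.1.2 * ‖R s‖
      ≤ 4 * (C3Gen d L * ((L : ℝ) ^ j) ^ 2) * b⁻¹ * ‖P‖ * ‖Q‖ * (2 * d * ‖R‖) :=
        mul_le_mul_of_nonneg_left (sum_kerQdd_mul_norm_le S L hL1 j z κ R) hK
    _ = 8 * d * (C3Gen d L * ((L : ℝ) ^ j) ^ 2) * b⁻¹ * ‖P‖ * ‖Q‖ * ‖R‖ := by ring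

include hL hG hU₀ hα hα3 hα4 h52 hb hsmall hc₃ h145 h155 in
/-- **SIZE OF THE THIRD SLICE DERIVATIVE along an inserted line**: `‖(d³/dt³)C_j(U₀, t·ins_S a)(c)|₀‖ ≤ 8d·C₃·(Lʲ)²·b⁻¹·‖a‖³` (the diagonal
of `norm_third_fderiv_CCovIter_ins_le'`; so `‖C_j⁽³⁾(U₀, ins_S a)(c)‖ ≤ (4/3)d·C₃(Lʲ)²b⁻¹‖a‖³`). [cite: Balaban1985Averaging, (136) p.39, (149) p.40] -/
theorem norm_iteratedDeriv_three_CCovIter_ins_slice_le {j : ℕ} (hj : j ≤ k) (z : Site d) (κ : Fin d) (a : S → 𝔸) :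
    ‖iteratedDeriv 3 (fun t : ℂ => CCovIter L U₀ (t • insCfg S a) j z κ) 0‖ ≤
      8 * d * (C3Gen d L * ((L : ℝ) ^ j) ^ 2) * b⁻¹ * ‖a‖ ^ 3 := by
  rw [iteratedDeriv_three_CCovIter_ins_slice L hL hG k U₀ hU₀ hα hα3 hα4 h52 hb hsmall hc₃ S hj z κ a]
  have h := norm_third_fderiv_CCovIter_ins_le' L hL hG k U₀ hU₀ hα hα3 hα4 h52 hb hsmall hc₃ h145 h155 S hj z κ a a a
  refine h.trans (le_of_eq ?_)
  ring

end Regime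

end Literature.MathematicalPhysics.QuantumFieldTheory.Balaban1983to89.B7Eq136ThirdPolarization

end
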